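import Literature.AlgebraicGeometry.Frobenioids.UnitTrivialModelType
import HarnessLib

/-!
# Frobenioids I, Theorem 5.1 (iv) proof: "the description of the kernel in Proposition 4.4, (iii)" for a
# Frobenioid of unit-trivial type — `O^×(A^birat) → Φ^gp(Base A)` is injective; Frobenius-normalized type
# (abc-iut cell, layer L1, node `FrdI:Thm5.1(iv)`, companions of sub-DAG row `FrdI:Thm5.1(iv)/T51iv-L05`)

Mochizuki, *The geometry of Frobenioids I: the general theory*, Kyushu J. Math. **62** (2008)
293–400, §5, Theorem 5.1 (iv), proof p. 100 ll. 1–4 [cite: MochizukiFrdI2008, Thm. 5.1 (iv) p.97], and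
§4, Proposition 4.4 (iii) p. 83 [cite: MochizukiFrdI2008, Prop. 4.4 (iii) p.83]: "we have a natural exact
sequence `1 → O^×(A) → O^×(A^birat) → Φ^birat(A) → 1`" — so for `C` of unit-trivial type
(`O^×(A) = {1}`) the divisor map `O^×(A^birat) → Φ^birat(A) ⊆ Φ^gp(A)` is INJECTIVE, which is the
"description of the kernel" the proof of Thm. 5.1 (iv) invokes.

PROOF-ONLY companion of `UnitTrivialModelType.lean` (this seat) over THE birationalization (seat
abc-iut-L6-t8 `Birat` / seat abc-iut-L6-t6 `biratData`, divisor homomorphism `biratDivHom`):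
* `biratDivHom_injective_of_isOfUnitTrivialType` — for a Frobenioid of isotropic and unit-trivial type,
  `O^×(A^birat) → Φ^gp(Base A)`, `u ↦ Div(u)`, is injective (a unit with trivial divisor has the image
  of the identity under the FAITHFUL `C^birat → F_{Φ^gp}`, `Birat.toElemGp_faithful`); with seat
  abc-iut-L6-t6's `biratDivHom_mem` this is the embedding `O^×(A^birat) ↪ Φ^birat(Base A)`;
* `isOfFrobeniusNormalizedType_of_isOfUnitTrivialType` — a Frobenioid of isotropic and unit-trivial
  type is of Frobenius-normalized type (Def. 1.2 (iv)/(v)), its structure functor being faithful.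
Nothing is defined; no statement of the paper is strengthened; no side is taken on [IUTchIII] Cor. 3.12.
-/

namespace Literature.AlgebraicGeometry.Frobenioids

namespace PreFrobenioid

open CategoryTheory Opposite

universe w v v' u u'

variable {D : Type u} [Category.{v} D] {Φ : Dᵒᵖ ⥤ CommMonCat.{w}}
  {C : Type u'} [Category.{v'} C] {F : C ⥤ ElemFrobenioid Φ}

/-- **Prop. 4.4 (iii), kernel clause, for `C` of unit-trivial type** (the step of the proof of Thm. 5.1
(iv), FrdI p. 100): for a Frobenioid of isotropic and unit-trivial type and any object `A`, the divisor
homomorphism `O^×(A^birat) → Φ^gp(Base A)` of THE birationalization is injective.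
[cite: MochizukiFrdI2008, Prop. 4.4 (iii) p.83] -/
theorem biratDivHom_injective_of_isOfUnitTrivialType (hF : IsFrobenioid F) (hsq : HasBiratSquares F)
    (hiso : IsOfIsotropicType F) (hut : IsOfUnitTrivialType F) (A : C) :
    Function.Injective (biratDivHom hF hsq A) := by
  haveI := Birat.toElemGp_faithful hF hsq hiso hut
  refine (injective_iff_map_eq_one _).mpr fun u hu => ?_
  obtain ⟨hb, hl⟩ := u.2
  have hb' : ElemFrobenioid.Base ((Birat.toElemGp hF hsq).map u.1.hom) = 𝟙 _ := hb
  have hl' : ElemFrobenioid.degFr ((Birat.toElemGp hF hsq).map u.1.hom) = 1 := hl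
  have hd : ElemFrobenioid.Div ((Birat.toElemGp hF hsq).map u.1.hom) = 1 := hu
  have h1 : (Birat.toElemGp hF hsq).map u.1.hom = (Birat.toElemGp hF hsq).map (𝟙 _) := by
    rw [(Birat.toElemGp hF hsq).map_id]
    exact ElemFrobenioid.Hom.ext hb' hd hl'
  have h2 : u.1.hom = 𝟙 _ := (Birat.toElemGp hF hsq).map_injective h1
  exact Subtype.ext (Iso.ext h2)

/-- **Prop. 4.4 (iii) for `C` of unit-trivial type, assembled**: `O^×(A^birat) ↪ Φ^birat(Base A)` — the
divisor homomorphism is injective with values in the rational function monoid (seat abc-iut-L6-t6's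
`biratDivHom_mem`). [cite: MochizukiFrdI2008, Prop. 4.4 (iii) p.83] -/
theorem biratDivHom_injective_mem_of_isOfUnitTrivialType (hF : IsFrobenioid F) (hsq : HasBiratSquares F)
    (hiso : IsOfIsotropicType F) (hut : IsOfUnitTrivialType F) (A : C) :
    Function.Injective (biratDivHom hF hsq A) ∧
      ∀ u, biratDivHom hF hsq A u ∈ biratSubgroup F (baseObj F A) :=
  ⟨biratDivHom_injective_of_isOfUnitTrivialType hF hsq hiso hut A, fun u => biratDivHom_mem u⟩

variable (F) in
/-- A Frobenioid of isotropic and unit-trivial type is of Frobenius-normalized type (Def. 1.2 (iv)/(v)):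
its structure functor `C → F_Φ` is faithful (`faithful_of_isOfUnitTrivialType`, Thm. 5.1 (iv) proof) and
a pre-Frobenioid with faithful structure functor is of Frobenius-normalized type
(`isFrobeniusNormalized_of_faithful`). [cite: MochizukiFrdI2008, Thm. 5.1 (iv) p.100] -/
theorem isOfFrobeniusNormalizedType_of_isOfUnitTrivialType (hF : IsFrobenioid F)
    (hiso : IsOfIsotropicType F) (hut : IsOfUnitTrivialType F) : IsOfType (IsFrobeniusNormalized F) :=
  haveI := faithful_of_isOfUnitTrivialType F hF hiso hut
  fun A => isFrobeniusNormalized_of_faithful F A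

end PreFrobenioid

end Literature.AlgebraicGeometry.Frobenioids
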